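import Summits.BirchSwinnertonDyer.BirchSwinnertonDyer.Theorems.SchneiderFreeUpperSockets
import Summits.BirchSwinnertonDyer.Rank1Residual.Supersingular.X6RankOneGoodHalvesPointwise
import Summits.BirchSwinnertonDyer.Rank1Residual.X11b.CharIdealTrivialCharacter
import HarnessLib

/-!
# Schneider-free additive X3 door, SECOND WING — the UPPER RECEPTACLE: the Kolyvagin-direction
# divisibility `(L) ⊆ Ch_Λ(X)·R₀⟦T⟧` and the value `L(0) = u·(log_ω P / c)²` with a UNIT cofactor give
# co-T-B6-1 `n + 2·v_p(c) ≤ 2·ord_p log_ω P` (Theses-free norm algebra, every `p`)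

Cell `bsd-schneider-ideate`, seat `bsd-schneider-door-c5` (prover, generation 8). Mirror of door-c3's
lower receptacle (`Theorems/SchneiderFreeAdditiveX3GordTwoBranchIMCReceptacle.lean`:
`two_mul_valuation_le_of_hasValueAt_sq`, `additiveIMCLowerBDPOnTreeLeAt_of_value_of_dvd`) for the
co-socket `Upper.AdditiveIMCUpperBDPOnTreeLeAt` of memo `ROUTE-P2-upper-v1-g13.md` (U5, U12).

THE ASYMMETRY (a finding, recorded in the statements): the LOWER receptacle works with ANY integral
cofactor `u ∈ R₀` in the value formula (`‖f(0)‖ ≤ ‖L(0)‖ = ‖u‖‖y‖² ≤ ‖y‖²`); the UPPER receptacle needs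
`‖u‖ = 1`, i.e. `u` a UNIT of `R₀` (`‖y‖² = ‖u‖‖y‖² = ‖L(0)‖ ≤ ‖f(0)‖`), and it needs `y ≠ 0` as an INPUT
(for the lower one it came out). So the wing's CH-type input (`stub_CH`'s co-version) must assert that the
cofactor of the conductor-`p` value formula is a `p`-adic UNIT in the chosen period normalisation — the
root-number / Gauss-sum multiplier of size `p^{2n}` at conductor `p^n` (Castella–Hsieh Prop. 3.8) must be
absorbed into `Ω_p`, as the door's H1 docstring already prescribes; with a non-unit cofactor of valuation
`t` one would only get `n + 2s ≤ 2·ord_p log_ω P + t`.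

* §1 `valuation_le_two_mul_of_sq_le` (norm ⟶ valuation), `two_mul_valuation_ge_of_hasValueAt_sq_unit`
  (`L ∈ (f)·R₀⟦T⟧`, `L(0) = u·y²`, `u` a unit, `y ≠ 0` ⟹ `ord_p f(0) ≤ 2·ord_p y`).
* §2 `additiveIMCUpperBDPOnTreeLeAt_of_value_of_dvd'` — CTL₀ (`HasCharValuationAt … n`) ∧
  `Ideal.span {L} ≤ Ch.map` ∧ `L.HasValueAt 0 (u·(log_ω P/c)²)` with `u : (R₀)ˣ` ∧ `log_ω P ≠ 0` ∧ `c ≠ 0`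
  ⟹ `Upper.AdditiveIMCUpperBDPOnTreeLeAt p κ 𝔭 γ ι (v_p c) P`; `coDivisibilityLe_of_value_of_dvd'` (the
  inequality for every CTL₀ witness).

HONEST FRAMING: pure `p`-adic norm algebra and bookkeeping; nothing asserted about elliptic curves beyond the
displayed hypotheses; BSD not advanced. References: [Castella2018] §5 (5.1)–(5.3) (arXiv:1704.06608 p. 12);
[CastellaHsieh2018] Prop. 3.8, Thm. 5.7 (arXiv:1505.08165); [JetchevSkinnerWan2017] §7.4.1.
-/

noncomputable section

open scoped Classical

open WeierstrassCurve NumberField IsDedekindDomain Field PowerSeries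
  Literature.NumberTheory.EllipticCurves
  Literature.NumberTheory.EllipticCurves.GreenbergSelmer
  Literature.NumberTheory.EllipticCurves.Rank1Residual
  Summit.BirchSwinnertonDyer.Rank1Residual
  Summit.BirchSwinnertonDyer.Rank1Residual.X11b
  Summit.BirchSwinnertonDyer.Rank1Residual.X11b.AcSelmer
  Summit.BirchSwinnertonDyer.Rank1Residual.X11b.Halves
  Summit.BirchSwinnertonDyer.Rank1Residual.X11b.CongruenceLimit

set_option linter.dupNamespace false
set_option autoImplicit false

namespace Summit.BirchSwinnertonDyer.BirchSwinnertonDyer.Theorems.SchneiderFree.Upper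

/-! ### §1 Norm algebra in `ℂ_p`, upper direction -/

section Receptacle

variable (p : ℕ) [Fact p.Prime]

/-- `‖y‖² ≤ ‖x‖` for `y ∈ ℚ_p^×`, `x ∈ ℤ_p ∖ 0` gives `ord_p x ≤ 2·ord_p y` (norms are `p^{−ord}`). [folklore] -/
theorem valuation_le_two_mul_of_sq_le {x : ℤ_[p]} (hx : x ≠ 0) {y : ℚ_[p]} (hy : y ≠ 0)
    (h : ‖y‖ ^ 2 ≤ ‖(x : ℚ_[p])‖) : (x.valuation : ℤ) ≤ 2 * y.valuation := by
  have hp1 : (1 : ℝ) < p := by exact_mod_cast (Fact.out : p.Prime).one_lt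
  rw [← PadicInt.norm_def, PadicInt.norm_eq_zpow_neg_valuation hx,
    Padic.norm_eq_zpow_neg_valuation hy] at h
  have hrhs : ((p : ℝ) ^ (-y.valuation)) ^ 2 = (p : ℝ) ^ (-(2 * y.valuation)) := by
    rw [← zpow_natCast ((p : ℝ) ^ (-y.valuation)) 2, ← zpow_mul]
    congr 1
    push_cast
    ring
  rw [hrhs, zpow_le_zpow_iff_right₀ hp1] at h
  omega

/-- **The norm algebra of the UPPER receptacle (every `p`).** If `f ∈ Λ = ℤ_p⟦T⟧` has non-zero constant
term, `L ∈ (f)·R₀⟦T⟧` (the Kolyvagin-direction divisibility `(L) ⊆ Ch·R₀⟦T⟧`), and `L(0) = u·y²` with a UNIT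
`u ∈ R₀^×` and `y ∈ ℚ_p^×`, then `ord_p f(0) ≤ 2·ord_p y`:
`‖y‖² = ‖u‖·‖y‖² = ‖L(0)‖ = ‖G(0)‖·‖f(0)‖ ≤ ‖f(0)‖`. The unit and `y ≠ 0` are genuinely needed here
(contrast the lower receptacle `two_mul_valuation_le_of_hasValueAt_sq`, where `u` integral suffices and
`y ≠ 0` comes out). [folklore] -/
theorem two_mul_valuation_ge_of_hasValueAt_sq_unit {f : IwasawaAlgebra p} (hf0 : constantCoeff f ≠ 0)
    {L : UnrSeries p} (hLf : L ∈ Ideal.span {PowerSeries.map (toUnr p) f})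
    (u : (unrIntegers p)ˣ) {y : ℚ_[p]} (hy : y ≠ 0)
    (hL : L.HasValueAt 0 ((((u : unrIntegers p)) : ℂ_[p]) * (algebraMap ℚ_[p] ℂ_[p] y) ^ 2)) :
    ((constantCoeff f).valuation : ℤ) ≤ 2 * y.valuation := by
  -- `L(0)` is the constant term
  have hL0 : (((u : unrIntegers p)) : ℂ_[p]) * (algebraMap ℚ_[p] ℂ_[p] y) ^ 2 =
      ((constantCoeff L : unrIntegers p) : ℂ_[p]) :=
    UnrSeries.eq_constantCoeff_of_hasValueAt_zero hL
  -- `L = G·f`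
  obtain ⟨G, hG⟩ := Ideal.mem_span_singleton'.mp hLf
  have hfac : ((constantCoeff L : unrIntegers p) : ℂ_[p]) =
      ((constantCoeff G : unrIntegers p) : ℂ_[p]) *
        algebraMap ℚ_[p] ℂ_[p] ((constantCoeff f : ℤ_[p]) : ℚ_[p]) := by
    rw [← coe_toUnr, ← constantCoeff_map_apply (toUnr p) f, ← hG, map_mul, Subring.coe_mul]
  -- norms
  have hnorm : ‖y‖ ^ 2 ≤ ‖((constantCoeff f : ℤ_[p]) : ℚ_[p])‖ := by
    calc ‖y‖ ^ 2 = ‖algebraMap ℚ_[p] ℂ_[p] y‖ ^ 2 := by rw [norm_algebraMap']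
      _ = ‖(((u : unrIntegers p)) : ℂ_[p])‖ * ‖algebraMap ℚ_[p] ℂ_[p] y‖ ^ 2 := by
          rw [norm_coe_units_unrIntegers, one_mul]
      _ = ‖((constantCoeff L : unrIntegers p) : ℂ_[p])‖ := by rw [← hL0, norm_mul, norm_pow]
      _ = ‖((constantCoeff G : unrIntegers p) : ℂ_[p])‖ *
            ‖algebraMap ℚ_[p] ℂ_[p] ((constantCoeff f : ℤ_[p]) : ℚ_[p])‖ := by rw [hfac, norm_mul]
      _ ≤ 1 * ‖algebraMap ℚ_[p] ℂ_[p] ((constantCoeff f : ℤ_[p]) : ℚ_[p])‖ :=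
          mul_le_mul_of_nonneg_right (norm_coe_unrIntegers_le_one p _) (norm_nonneg _)
      _ = ‖((constantCoeff f : ℤ_[p]) : ℚ_[p])‖ := by rw [one_mul, norm_algebraMap']
  exact valuation_le_two_mul_of_sq_le p hf0 hy hnorm

end Receptacle

/-! ### §2 The pointwise UPPER receptacle of the co-socket (every `p`, every embedding, every `c`) -/

section Pointwise

variable {p : ℕ} [Fact p.Prime] {K : Type} [Field K] [NumberField K]
  {W : WeierstrassCurve ℚ} [W.IsElliptic] [W.IsGloballyMinimal] {κ : ZpExtension K p}
  {𝔭 : HeightOneSpectrum (𝓞 K)} {γ : Field.absoluteGaloisGroup K} [Fact (κ.IsTopGenerator γ)]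
  {ι : K →+* ℚ_[p]} {P : (W.baseChange K).toAffine.Point}

/-- **Kolyvagin-direction divisibility + value with a UNIT cofactor ⟹ the co-socket, pointwise (every `p`).**
CTL₀ (`HasCharValuationAt … n`) ∧ `(L) ⊆ Ch_Λ(X_ac^∅)·R₀⟦T⟧` (the "⊆ Char" half of a branch main
conjecture, e.g. Keller–Yin 2410.23241 Thm. 3.5.1 read as `(L₀) ≤ Char` — memo U12, `span_le_charIdeal_map_of_thm351_OPEN`)
∧ the value shape at the trivial character `L(0) = u·(log_{ω_E} P / c)²` with a UNIT cofactor `u ∈ R₀^×` ∧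
`log_{ω_E} P ≠ 0` (P non-torsion) ∧ `c ≠ 0` ⟹ `Upper.AdditiveIMCUpperBDPOnTreeLeAt p κ 𝔭 γ ι (v_p c) P`, i.e.
`n + 2·v_p(c) ≤ 2·ord_p log_{ω_E} P` with the SAME `n`. [cite: Castella2018, §5 (5.1)–(5.3) (arXiv:1704.06608 p. 12) (the assembly, reversed)]
[cite: JetchevSkinnerWan2017, §7.4.1 (arXiv:1512.06894 p. 30)] -/
theorem additiveIMCUpperBDPOnTreeLeAt_of_value_of_dvd' {n : ℕ}
    (hn : XAc.HasCharValuationAt (W.baseChange K) p κ 𝔭 ∅ γ n) {L : UnrSeries p}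
    (h3 : Ideal.span {L} ≤ (XAc.charIdeal (W.baseChange K) p κ 𝔭 ∅ γ).map (PowerSeries.map (toUnr p)))
    (u : (unrIntegers p)ˣ) {c : ℤ} (hc : c ≠ 0) (hlog : logOmega W p ι P ≠ 0)
    (h2 : L.HasValueAt 0 ((((u : unrIntegers p)) : ℂ_[p]) *
      (algebraMap ℚ_[p] ℂ_[p] (logOmega W p ι P / (c : ℚ_[p]))) ^ 2)) :
    AdditiveIMCUpperBDPOnTreeLeAt p κ 𝔭 γ ι (padicValNat p c.natAbs) P := by
  obtain ⟨htors, f, hf, hf0, hfn⟩ := hn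
  have hmem : L ∈ Ideal.span {PowerSeries.map (toUnr p) f} := by
    rw [hf, map_span_singleton_powerSeries] at h3
    exact (Ideal.span_singleton_le_iff_mem _).mp h3
  have hc0 : (c : ℚ_[p]) ≠ 0 := by exact_mod_cast hc
  have hy0 : logOmega W p ι P / (c : ℚ_[p]) ≠ 0 := div_ne_zero hlog hc0
  have hle := two_mul_valuation_ge_of_hasValueAt_sq_unit p hf0 hmem u hy0 h2
  rw [div_eq_mul_inv, Padic.valuation_mul hlog (inv_ne_zero hc0), Padic.valuation_inv,
    Padic.valuation_intCast, valuation_logOmega hlog, hfn] at hle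
  refine ⟨n, ⟨htors, f, hf, hf0, hfn⟩, ?_⟩
  simp only [padicValInt] at hle
  have : (padicValNat p c.natAbs : ℤ) = (padicValNat p c.natAbs : ℤ) := rfl
  linarith

/-- **The co-divisibility inequality for EVERY CTL₀ witness** (`XAc.HasCharValuationAt.unique`): with the
inputs of `additiveIMCUpperBDPOnTreeLeAt_of_value_of_dvd'`, `n + 2·v_p(c) ≤ 2·ord_p log_{ω_E} P`.
[cite: Castella2018, Thm. 2.3 and §5 (5.1) (arXiv:1704.06608 pp. 5, 12)] -/
theorem coDivisibilityLe_of_value_of_dvd' {n : ℕ}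
    (hn : XAc.HasCharValuationAt (W.baseChange K) p κ 𝔭 ∅ γ n) {L : UnrSeries p}
    (h3 : Ideal.span {L} ≤ (XAc.charIdeal (W.baseChange K) p κ 𝔭 ∅ γ).map (PowerSeries.map (toUnr p)))
    (u : (unrIntegers p)ˣ) {c : ℤ} (hc : c ≠ 0) (hlog : logOmega W p ι P ≠ 0)
    (h2 : L.HasValueAt 0 ((((u : unrIntegers p)) : ℂ_[p]) *
      (algebraMap ℚ_[p] ℂ_[p] (logOmega W p ι P / (c : ℚ_[p]))) ^ 2)) :
    (n : ℤ) + 2 * (padicValNat p c.natAbs : ℤ) ≤ 2 * X11b.padicLogOrd W p ι P := by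
  obtain ⟨n', hn', hle⟩ := additiveIMCUpperBDPOnTreeLeAt_of_value_of_dvd' hn h3 u hc hlog h2
  obtain rfl : n = n' := hn.unique hn'
  exact hle

end Pointwise

end Summit.BirchSwinnertonDyer.BirchSwinnertonDyer.Theorems.SchneiderFree.Upper

end
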